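import Summits.QuantumFields.YangMills.Theorems.UnitScaleTiltProp7OneFormGreenBlockDivergenceKFree
import Summits.QuantumFields.YangMills.Theorems.UnitScaleTiltProp7OneFormGreenBlockSupKFree
import Summits.QuantumFields.YangMills.Theorems.UnitScaleTiltProp7GreenPiBlockLettersEdition
import HarnessLib

/-!
# Route `UnitScaleTilt`, crux K1 «MinimiserStabilityRegPr» (stmt-QuantumFields-19200), EX face, norm_G ∕ h133 road — **(V0)+(D0): THE SUP VALUE ROW AND THE SUP
# COVARIANT-DIVERGENCE ROW OF `G₀ = Δ_a(U₀)⁻¹` ON SUP-BOUNDED SOURCES** — the `hV` ∕ `hDiv` letters of ★p1's FILE C ✓`Prop7GreenPiSupRowsOfLetters.valueDiv_rows_GTpi_of_letters`,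
# of px17's (O-G1) ✓`Prop7GreenOneSupRowsOfLetters.valueDiv_rows_GTone_of_letters` and of ✓`Prop7GreenPiGradientRowOfLetters` §3, TOKEN FOR TOKEN
# (`∀ X s, (∀ b, ‖X b‖ ≤ s) → ∀ bd, ‖toL2⁻¹(G₀(toL2 X)) bd‖ ≤ BV·s` and `… → ∀ x, ‖toL2S⁻¹(D*_{U₀}(G₀(toL2 X))) x‖ ≤ BD·s`) — in MEMBER and K-FREE-MEMBER
# currency (L-only FAMILY: sibling `…OneFormGreenSupRowsFamily`), FROM THE LANDED BLOCK-SUPPORTED ROWS (Gb) ∕ (Db) by ✓`Prop7GreenPiBlockLettersEdition.weighted_of_blockSupported` at weight rate `0` (block pieces of the source,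
# coarse volume `(2(1+1∕δ₁))³`).  (width seat `ym3-torus-px21` g16; successor pen named by px21 g15 ■ «(D0) = (Db)-SUP».)

Cell `ym3-torus` (HUMAN RULING D-0037; rung R3 = SU(2) YM₃ on T³ — NOT d = 4, NOT infinite volume, NOT a mass gap, NOT Clay).  THEOREMS ONLY (0 `def`, 0 `sorry`, default
heartbeats); `--supports stmt-QuantumFields-19200 --as helper`; count-neutral.

WHY NOTHING NEW IS ANALYSED HERE ([Balaban1985BackgroundPropagators] (3.47)–(3.49): «|Gf|, |∇Gf|, |G∇*f| ≤ B|f|» follow from the exponentially decaying block estimates by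
summation over blocks).  A block-supported decayed letter at rate `δ₁ > 0` with constant `C` for a block-additive reader `Φ` IS the flat sup letter with constant `C·(2(1+1∕δ₁))³`:
split the source into its block pieces, apply the letter per piece, sum `Σ_z e^{−δ₁·dc(·,z)} ≤ (2(1+1∕δ₁))³` (✓`sum_exp_neg_mul_tdist_coarse_le` inside ✓`weighted_of_blockSupported`,
read at weight rate `0`).  The block rows are LANDED: (Gb) px16 ✓`Prop7OneFormGreenSupBound.norm_symm_GT_apply_le_of_blockSupport` ∕ ✓`blockSup_GT_DeltaEtaSlot_kfree`; (Db) px21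
✓`Prop7OneFormGreenBlockDivergence.norm_symm_DstarL2_GT_le_of_blockSupport` ∕ ✓`divergence_GT_DeltaEtaSlot_kfree`.

WHAT IS PROVED (ns `Summit.QuantumFields.YangMills.Theorems.Prop7OneFormGreenSupRowsOfBlockRows`).
* §1 ★ `sup_of_blockSupported` — ABSTRACT: block letter at rate `δ₁ > 0` ⟹ flat sup letter `∀ Y m, (∀ i, ‖Y i‖ ≤ m) → ∀ k, ‖Φ Y k‖ ≤ C·(2(1+1∕δ₁))³·m` (`0 ≤ C` and `0 ≤ m` are READ OFF
  the letters at the zero source ∕ one index — no sign hypotheses displayed); `valueReader_blockAdditive`, `divReader_blockAdditive` (the two readers are block-additive, `map_sum`).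
* §2 ★★★ `norm_symm_DstarL2_GT_le_of_sup` — **(D0) AT THE MEMBER**: at the (dκ) letters VERBATIM + the decayed VALUE row quantified over block-supported sources (`hvalb`, px16 §3's
  conclusion text) + the no-wrap room + the gradient margin (= F1 ✓`Prop7OneFormGreenBlockGradient.norm_nabla115_GT_le_of_sup`'s hypotheses, token for token): the `hDiv` TEXT
  with `BD := C_D·(2(1+1∕κ₁))³`, `κ₁ = min r ¼ ∕ 2`, `C_D` = (dκ)'s printed constant.  (The VALUE twin at the member is N4 §2 ✓`norm_symm_GT_apply_le_of_letters` — not restated.)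
* §3 ★★★ `value_GT_DeltaEtaSlot_sup_kfree` — **(V0)-K**: hypotheses = ✓`blockSup_GT_DeltaEtaSlot_kfree`'s VERBATIM (`n < K`; `RegPr` + the three `ε₀` windows; `Lift`; coupling window
  `0 ≤ a ≤ a₁(c₀∕cB)ℓ³`; (γ) `hco`, `0 < γ`; `hk_D` in the `C_K·ℓ⁻³·e^{−δ_K d}` currency; the budgets) ⟹ the `hV` TEXT with the MEMBER-FREE `BV⋆·(2(1+1∕κ₁))³` (`BV⋆ = C_G∕2` printed);
  ★★★ `divergence_GT_DeltaEtaSlot_sup_kfree` — **(D0)-K**: hypotheses = ✓`divergence_GT_DeltaEtaSlot_kfree`'s VERBATIM (the same + room + the K-free margin) ⟹ the `hDiv` TEXT with the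
  MEMBER-FREE `C_D⋆·(2(1+1∕κ₁))³`.
  ★★ `exists_valueDiv_sup_kfree` — the two as ONE `∃ BV BD, 0 ≤ BV ∧ 0 ≤ BD ∧ hV-text ∧ hDiv-text` (FILE C's four slots `hBV hBD hV hDiv`, texts VERBATIM).
  (The L-only FAMILY editions are the sibling file `…OneFormGreenSupRowsFamily`.)
HYP-SAT (★★OWNER RULING №42).  §1 abstract (any `Φ`); §2∕§3 display exactly the letters of the landed block theorems they re-read (inhabited as recorded there: (γ) ✓`hco_DeltaEtaSlot_exists`,
hk_D ✓`kernelRow349_allMembers_exists`, `Lift`, `RegPr`, budgets satisfiable on free parameters, `hroom` CHAIR WORD №1 class); conclusions non-vacuous; no `Prop` placeholder; nothing conclusion-shaped is assumed.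
HONEST SCOPE.  Bookkeeping over landed rows (block pieces + coarse volume); no kernel estimate is proved here; CONDITIONAL on the displayed letters; nothing of FILE C, (O-G1), `norm_G`,
`h133`, the 8 EX rows, `hThm2S`, EX `stub_existenceMinimalOrbit`, 19200 or the rung is proved here; no summit is proved by a helper; the Yang–Mills mass gap is NOT proved.

References: T. Bałaban, CMP **99** (1985) 389–434 [Balaban1985BackgroundPropagators] (Thm 3.1 (3.42)–(3.44) p.397, Thm 3.3 (3.47)–(3.49) pp.398–399, Thm 3.11 p.416, Thm 3.12
p.422–423); CMP **102** (1985) 277–309 [Balaban1985Variational] ((19) p.281, (134)–(135) p.298).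
-/

set_option autoImplicit false

noncomputable section

open scoped Matrix.Norms.L2Operator BigOperators InnerProductSpace ComplexConjugate

namespace Summit.QuantumFields.YangMills.Theorems.Prop7OneFormGreenSupRowsOfBlockRows

open Literature.MathematicalPhysics.QuantumFieldTheory.Balaban1983to89
open Literature.MathematicalPhysics.QuantumFieldTheory.Balaban1983to89.T3ContinuumYM3Torus
open Literature.MathematicalPhysics.QuantumFieldTheory.Balaban1983to89.T3PrintedRegularMinimiser (RegPr)
open B15DeterminingSets (embIter)
open T3SectALandauChart (formComp bgUnits eta eta_pos)
open B9SectCLatticeCarrier (Bond)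
open B9Eq311L2Pairing (WL2)
open B11Eq103H1Complex (BondL2K SiteL2K)
open B5Eq118OneStroke (iterBlockOf)
open Summit.QuantumFields.YangMills.Theorems.Prop8Chart (emlIterU)
open Summit.QuantumFields.YangMills.Theorems.Prop7SectET3Transport (periodsT3 bondEquiv)
open Summit.QuantumFields.YangMills.Theorems.Prop7SectET3HilbertLetters (W₂ toL2 toL2S DL2 DstarL2)
open Summit.QuantumFields.YangMills.Theorems.Prop7SectET3WilsonHessian (DeltaEtaSlot)
open Summit.QuantumFields.YangMills.Theorems.Prop7SectET3GaugeProjector (RS)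
open Summit.QuantumFields.YangMills.Theorems.Prop7SectET3CurvedPropagators (laplaceA Qk GT PosOnto)
open Summit.QuantumFields.YangMills.Theorems.Prop7CurvedMemberLocalGradient (exists_curved_localGradient)
open Summit.QuantumFields.YangMills.Theorems.AxialGaugeChartGlue (norm_bgOfCfg_axialT_sub_le)
open Summit.QuantumFields.YangMills.Theorems.Prop7GreenPiBlockLettersEdition (weighted_of_blockSupported)
open Summit.QuantumFields.YangMills.Theorems.Prop7OneFormGreenBlockDivergence (norm_symm_DstarL2_GT_le_of_blockSupport)
open Summit.QuantumFields.YangMills.Theorems.Prop7OneFormGreenBlockDivergenceKFree (divergence_GT_DeltaEtaSlot_kfree)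
open Summit.QuantumFields.YangMills.Theorems.Prop7OneFormGreenBlockSupKFree (blockSup_GT_DeltaEtaSlot_kfree)

/-! ## §1 Block-supported letter ⟹ flat sup letter (weight rate `0`), and the two block-additive readers -/

section Abstract

variable {F : T3Family} {n K : ℕ}

/-- ★ **BLOCK-SUPPORTED DECAYED LETTER ⟹ FLAT SUP LETTER** (abstract; any block-additive reader `Φ`): if every input supported in block `z` with sup `≤ s` is mapped to outputs
`≤ s·C·e^{−δ₁·dc(loc k, z)}` with `δ₁ > 0`, then every input with `‖Y i‖ ≤ m` is mapped to outputs `≤ C·(2(1+1∕δ₁))³·m` — ✓`weighted_of_blockSupported` at weight rate `0`, `ν := δ₁`;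
`0 ≤ C` is read off the letter at the zero source, `0 ≤ m` off `hY` at one index. [cite: Balaban1985BackgroundPropagators, (3.47)–(3.49) pp.398–399] -/
theorem sup_of_blockSupported {ι κ : Type*} [Nonempty ι] (blk : ι → Site (F.P K) (K - n)) (loc : κ → Site (F.P K) (K - n))
    (Φ : (ι → Matrix (Fin 2) (Fin 2) ℂ) → κ → Matrix (Fin 2) (Fin 2) ℂ)
    (hΦ : ∀ f : Site (F.P K) (K - n) → ι → Matrix (Fin 2) (Fin 2) ℂ, Φ (∑ z, f z) = ∑ z, Φ (f z))
    {C δ₁ : ℝ} (hδ₁ : 0 < δ₁)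
    (hblk : ∀ (X : ι → Matrix (Fin 2) (Fin 2) ℂ) (z : Site (F.P K) (K - n)), (∀ i, X i ≠ 0 → blk i = z) → ∀ s : ℝ, 0 ≤ s → (∀ i, ‖X i‖ ≤ s) →
      ∀ k, ‖Φ X k‖ ≤ s * C * Real.exp (-(δ₁ * (Site.tdist (loc k) z : ℝ))))
    (Y : ι → Matrix (Fin 2) (Fin 2) ℂ) (m : ℝ) (hY : ∀ i, ‖Y i‖ ≤ m) (k : κ) :
    ‖Φ Y k‖ ≤ C * (2 * (1 + 1 / δ₁)) ^ 3 * m := by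
  classical
  obtain ⟨i₀⟩ := ‹Nonempty ι›
  have hm : 0 ≤ m := (norm_nonneg _).trans (hY i₀)
  -- `0 ≤ C` off the block letter at the ZERO source
  have hC : 0 ≤ C := by
    have h0 := hblk (fun _ => 0) (blk i₀) (fun i hi => absurd rfl hi) 1 zero_le_one (fun _ => by rw [norm_zero]; exact zero_le_one) k
    rw [one_mul] at h0
    exact (mul_nonneg_iff_of_pos_right (Real.exp_pos _)).mp ((norm_nonneg _).trans h0)
  -- weight rate `0`: the flat source letter
  have hY0 : ∀ i, ‖Y i‖ ≤ m * Real.exp (-(0 * (Site.tdist (blk i) (blk i₀) : ℝ))) := fun i => by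
    rw [zero_mul, neg_zero, Real.exp_zero, mul_one]; exact hY i
  have hw := weighted_of_blockSupported (F := F) (n := n) (K := K) blk loc Φ hΦ hC le_rfl hδ₁ (le_of_eq (zero_add _)) hblk (blk i₀) Y m hm hY0 k
  rwa [zero_mul, neg_zero, Real.exp_zero, mul_one] at hw

end Abstract

section Readers

variable (F : T3Family) {n K : ℕ} (h : n ≤ K) (c₀ cB a : ℝ) [Fact (0 < c₀)] [Fact (0 < cB)] (U₀ : GaugeField (F.P K) 0 (Matrix.specialUnitaryGroup (Fin 2) ℂ))

/-- The VALUE reader `X ↦ (bd ↦ toL2⁻¹(G₀(toL2 X)) bd)` is block-additive (linearity of `toL2`, `G₀`, `toL2⁻¹`). [folklore] -/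
theorem valueReader_blockAdditive :
    ∀ f : Site (F.P K) (K - n) → PBond (F.P K) 0 → Matrix (Fin 2) (Fin 2) ℂ,
      (fun (Y : PBond (F.P K) 0 → Matrix (Fin 2) (Fin 2) ℂ) (bd : PBond (F.P K) 0) =>
          (toL2 F K c₀).symm (GT F n K h c₀ cB a (DeltaEtaSlot F n K c₀) U₀ (toL2 F K c₀ Y)) bd) (∑ z, f z)
        = ∑ z, (fun (Y : PBond (F.P K) 0 → Matrix (Fin 2) (Fin 2) ℂ) (bd : PBond (F.P K) 0) =>
          (toL2 F K c₀).symm (GT F n K h c₀ cB a (DeltaEtaSlot F n K c₀) U₀ (toL2 F K c₀ Y)) bd) (f z) := by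
  intro f
  funext bd
  simp only [Finset.sum_apply]
  rw [map_sum, map_sum, map_sum, Finset.sum_apply]

/-- The DIVERGENCE reader `X ↦ (x ↦ toL2S⁻¹(D*_{U₀}(G₀(toL2 X))) x)` is block-additive (linearity of `toL2`, `G₀`, `D*`, `toL2S⁻¹`). [folklore] -/
theorem divReader_blockAdditive :
    ∀ f : Site (F.P K) (K - n) → PBond (F.P K) 0 → Matrix (Fin 2) (Fin 2) ℂ,
      (fun (Y : PBond (F.P K) 0 → Matrix (Fin 2) (Fin 2) ℂ) (x : Site (F.P K) 0) =>
          (toL2S F K c₀).symm (DstarL2 F n K c₀ U₀ (GT F n K h c₀ cB a (DeltaEtaSlot F n K c₀) U₀ (toL2 F K c₀ Y))) x) (∑ z, f z)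
        = ∑ z, (fun (Y : PBond (F.P K) 0 → Matrix (Fin 2) (Fin 2) ℂ) (x : Site (F.P K) 0) =>
          (toL2S F K c₀).symm (DstarL2 F n K c₀ U₀ (GT F n K h c₀ cB a (DeltaEtaSlot F n K c₀) U₀ (toL2 F K c₀ Y))) x) (f z) := by
  intro f
  funext x
  simp only [Finset.sum_apply]
  rw [map_sum, map_sum, map_sum, map_sum, Finset.sum_apply]

end Readers

/-! ## §2 (D0) at the member: the `hDiv` letter at the (dκ) letters -/

section Member

variable (F : T3Family) {n K : ℕ} (c₀ : ℝ) [Fact (0 < c₀)] (U₀ : GaugeField (F.P K) 0 (Matrix.specialUnitaryGroup (Fin 2) ℂ))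
  {h : n ≤ K} {cB a : ℝ} [Fact (0 < cB)]

/-- ★★★ **(D0), THE SUP COVARIANT-DIVERGENCE ROW OF `G₀` ON SUP-BOUNDED SOURCES, AT THE MEMBER** — at the (dκ) letters of ✓`norm_symm_DstarL2_GT_le_of_blockSupport` with the
decayed VALUE row quantified over block-supported sources (`hvalb` = px16 ✓`Prop7OneFormGreenSupBound.norm_symm_GT_apply_le_of_blockSupport`'s conclusion, binders
`X z hXz s hs hX bd`) + the no-wrap room + the gradient margin (F1 ✓`norm_nabla115_GT_le_of_sup`'s hypotheses token for token): for EVERY bond field `X` with `‖X b‖ ≤ s`,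
`‖toL2S⁻¹(D*_{U₀}(G₀(toL2 X))) x‖ ≤ (C_D·(2(1+1∕κ₁))³)·s` — FILE C ∕ (O-G1)'s `hDiv` binder TEXT with `BD := C_D·(2(1+1∕κ₁))³`, `κ₁ = min r ¼ ∕ 2`
([Balaban1985BackgroundPropagators] Thm 3.3 (3.47)₃ `|G∇*f|`-class ∕ Thm 3.1 (3.42) `|∇G|, |G∇*| ≤ B` for the member's `G₀`, sup currency; here the covariant divergence OF `G₀f`).
PROOF: §1 `sup_of_blockSupported` for the divergence reader with the block letter (dκ) (fed `hval := hvalb X z hXz s hs hX`).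
[cite: Balaban1985BackgroundPropagators, Thm 3.1 (3.42)–(3.44) p.397, Thm 3.3 (3.47)–(3.49) pp.398–399, Thm 3.12 p.422; Balaban1985Variational, (19) p.281, (134)–(135) p.298] -/
theorem norm_symm_DstarL2_GT_le_of_sup (hnK : n ≤ K) {ε₀ : ℝ} (hε₀ : 0 < ε₀) (hε₀1 : ε₀ ≤ 1) (hreg : RegPr F n K ε₀ U₀)
    (hp : PosOnto F n K h c₀ cB a (DeltaEtaSlot F n K c₀) U₀)
    {r : ℝ} (hr : 0 < r) {γ CV θV ε : ℝ} (hε : 0 < ε) (hε1 : ε ≤ 1)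
    (hco : ∀ v : BondL2K ℂ 3 (periodsT3 F K) c₀ W₂, γ * ‖v‖ ^ 2 ≤ RCLike.re ⟪v, laplaceA F n K h c₀ cB a (DeltaEtaSlot F n K c₀) U₀ v⟫_ℂ)
    (hVlow : ∀ X : PBond (F.P K) 0 → Matrix (Fin 2) (Fin 2) ℂ,
      -(CV * ‖toL2 F K c₀ X‖ ^ 2) ≤ RCLike.re ⟪toL2 F K c₀ X, laplaceA F n K h c₀ cB a (DeltaEtaSlot F n K c₀) U₀ (toL2 F K c₀ X)⟫_ℂ
        - ∑ μ : Fin (F.P K).d, ‖DL2 F n K c₀ U₀ (toL2S F K c₀ (formComp X μ))‖ ^ 2)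
    (hVconj : ∀ φ : Site (F.P K) 0 → ℝ, (∀ x x' : Site (F.P K) 0, |φ x - φ x'| ≤ r * eta F n K * (Site.tdist x x' : ℝ)) →
      ∀ X : PBond (F.P K) 0 → Matrix (Fin 2) (Fin 2) ℂ,
      RCLike.re ⟪toL2 F K c₀ X, laplaceA F n K h c₀ cB a (DeltaEtaSlot F n K c₀) U₀ (toL2 F K c₀ X)⟫_ℂ
          - (∑ μ : Fin (F.P K).d, ‖DL2 F n K c₀ U₀ (toL2S F K c₀ (formComp X μ))‖ ^ 2) - θV * ‖toL2 F K c₀ X‖ ^ 2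
        ≤ RCLike.re ⟪toL2 F K c₀ (fun b => Real.exp (φ b.src) • X b), laplaceA F n K h c₀ cB a (DeltaEtaSlot F n K c₀) U₀ (toL2 F K c₀ (fun b => (Real.exp (φ b.src))⁻¹ • X b))⟫_ℂ
          - RCLike.re (∑ μ : Fin (F.P K).d, ⟪DL2 F n K c₀ U₀ (toL2S F K c₀ (formComp (fun b => Real.exp (φ b.src) • X b) μ)),
              DL2 F n K c₀ U₀ (toL2S F K c₀ (formComp (fun b => (Real.exp (φ b.src))⁻¹ • X b) μ))⟫_ℂ))
    (hΘ : 0 < ((1 - ε) * γ - ε * CV - 3 * (r ^ 2 * Real.exp (2 * r)) * (1 + 1 / ε) - θV))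
    {CkD CkQ μ' : ℝ} (hCkD : 0 ≤ CkD) (hCkQ : 0 ≤ CkQ) (hrμ : r < μ')
    (hkD : ∀ (b : PBond (F.P K) 0) (Z : Matrix (Fin 2) (Fin 2) ℂ) (bd : PBond (F.P K) 0),
      ‖(toL2 F K c₀).symm (DL2 F n K c₀ U₀ (DstarL2 F n K c₀ U₀ (toL2 F K c₀ (Pi.single b Z))
          - RS F n K h c₀ cB U₀ (DstarL2 F n K c₀ U₀ (toL2 F K c₀ (Pi.single b Z))))) bd‖
        ≤ CkD * Real.exp (-(μ' * (Site.tdist (P := F.P K) (iterBlockOf (K - n) b.src) (iterBlockOf (K - n) bd.src) : ℝ))) * ‖Z‖)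
    (hkQ : ∀ (b : PBond (F.P K) 0) (Z : Matrix (Fin 2) (Fin 2) ℂ) (bd : PBond (F.P K) 0),
      ‖(toL2 F K c₀).symm (LinearMap.adjoint (Qk F n K h c₀ cB U₀) (((a : ℝ) : ℂ) • Qk F n K h c₀ cB U₀ (toL2 F K c₀ (Pi.single b Z)))) bd‖
        ≤ CkQ * Real.exp (-(μ' * (Site.tdist (P := F.P K) (iterBlockOf (K - n) b.src) (iterBlockOf (K - n) bd.src) : ℝ))) * ‖Z‖)
    {AV : ℝ}
    (hvalb : ∀ (X : PBond (F.P K) 0 → Matrix (Fin 2) (Fin 2) ℂ) (z : Site (F.P K) (K - n)), (∀ b, X b ≠ 0 → iterBlockOf (K - n) b.src = z) →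
      ∀ s : ℝ, 0 ≤ s → (∀ b, ‖X b‖ ≤ s) →
      ∀ bd : PBond (F.P K) 0, ‖((toL2 F K c₀).symm (GT F n K h c₀ cB a (DeltaEtaSlot F n K c₀) U₀ (toL2 F K c₀ X))) bd‖ ≤ s * AV * Real.exp (-((min r (1 / 4) / 2) * (Site.tdist (P := F.P K) (iterBlockOf (K - n) bd.src) z : ℝ))))
    (hroom : 2 * (12 * F.L ^ (K - n) + 5) ≤ (F.P K).sitesPerDir 0)
    (hsmall : exists_curved_localGradient.choose * ((48 * ε₀) * (6 * Real.sqrt 2 * Real.sqrt 10 + 6 * Real.sqrt 2)) * Real.exp (51 * (min r (1 / 4) / 2)) ≤ 1 / 2)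
    :
    ∀ (X : PBond (F.P K) 0 → Matrix (Fin 2) (Fin 2) ℂ) (s : ℝ), (∀ b, ‖X b‖ ≤ s) →
      ∀ x : Site (F.P K) 0, ‖(toL2S F K c₀).symm (DstarL2 F n K c₀ U₀ (GT F n K h c₀ cB a (DeltaEtaSlot F n K c₀) U₀ (toL2 F K c₀ X))) x‖
        ≤ ((3 * (Real.exp (4 * (min r (1 / 4) / 2)) * (2 * ((exists_curved_localGradient.choose * (((Real.sqrt 2 * AV) * Real.exp (51 * (min r (1 / 4) / 2))) * (2 + 2 * Real.sqrt 2 * (4 * ε₀ * (3 + 2457 * norm_bgOfCfg_axialT_sub_le.choose)) + (24 * Real.sqrt 10 + 48) * (48 * ε₀) ^ 2) + (Real.sqrt 2 * ((32 * ε₀ * (AV * Real.exp (5 * (min r (1 / 4) / 2)))) + (CkD * Real.sqrt ((((F.P K).d : ℝ) * ((((F.P K).L : ℝ) ^ (F.P K).d) ^ (K - n))) / c₀) * (Real.exp (6 * r) * Real.sqrt (2 * c₀ * (((F.P K).d : ℝ) * ((((F.P K).L : ℝ) ^ (F.P K).d) ^ (K - n)))) / ((1 - ε) * γ - ε * CV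 - 3 * (r ^ 2 * Real.exp (2 * r)) * (1 + 1 / ε) - θV)) * (2 * (1 + 1 / (μ' - r))) ^ 3) + (CkQ * Real.sqrt ((((F.P K).d : ℝ) * ((((F.P K).L : ℝ) ^ (F.P K).d) ^ (K - n))) / c₀) * (Real.exp (6 * r) * Real.sqrt (2 * c₀ * (((F.P K).d : ℝ) * ((((F.P K).L : ℝ) ^ (F.P K).d) ^ (K - n)))) / ((1 - ε) * γ - ε * CV - 3 * (r ^ 2 * Real.exp (2 * r)) * (1 + 1 / ε) - θV)) * (2 * (1 + 1 / (μ' - r))) ^ 3) + 1)) * Real.exp (51 * (min r (1 / 4) / 2))) + 2 * Real.sqrt 2 * (48 * ε₀) * ((Real.sqrt 2 * AV) * Real.exp (51 * (min r (1 / 4) / 2)))))))) * (2 * (1 + 1 / (min r (1 / 4) / 2))) ^ 3) * s := by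
  intro X s hX x
  have hk1 : 0 < (min r (1 / 4) / 2) := by have := lt_min hr (by norm_num : (0 : ℝ) < 1 / 4); positivity
  haveI : Nonempty (PBond (F.P K) 0) := ⟨⟨x, ⟨0, by rw [T3Family.P_d]; norm_num⟩⟩⟩
  exact sup_of_blockSupported (fun b : PBond (F.P K) 0 => iterBlockOf (K - n) b.src) (fun x' : Site (F.P K) 0 => iterBlockOf (K - n) x')
    (fun (Y : PBond (F.P K) 0 → Matrix (Fin 2) (Fin 2) ℂ) (x' : Site (F.P K) 0) =>
      (toL2S F K c₀).symm (DstarL2 F n K c₀ U₀ (GT F n K h c₀ cB a (DeltaEtaSlot F n K c₀) U₀ (toL2 F K c₀ Y))) x')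
    (divReader_blockAdditive F h c₀ cB a U₀) hk1
    (fun Y z hYz t ht hY x' => norm_symm_DstarL2_GT_le_of_blockSupport F c₀ U₀ (h := h) (cB := cB) (a := a) hnK hε₀ hε₀1 hreg hp hr hε hε1 hco hVlow hVconj hΘ
      hCkD hCkQ hrμ hkD hkQ Y z hYz ht hY (hvalb Y z hYz t ht hY) hroom hsmall x')
    X s hX x

end Member

/-! ## §3 (V0)-K and (D0)-K: the K-free member editions under `Lift` -/

section KFree

variable (F : T3Family) {n K : ℕ} (h : n ≤ K) (c₀ cB : ℝ) [Fact (0 < c₀)] [Fact (0 < cB)]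

/-- ★★★ **(V0)-K: THE SUP VALUE ROW OF `G₀` ON SUP-BOUNDED SOURCES, UNDER `Lift`, MEMBER-FREE CONSTANT** — hypotheses = px16 ✓`blockSup_GT_DeltaEtaSlot_kfree`'s VERBATIM; conclusion
= FILE C ∕ (O-G1)'s `hV` binder TEXT `∀ X s, (∀ b, ‖X b‖ ≤ s) → ∀ bd, ‖toL2⁻¹(G₀(toL2 X)) bd‖ ≤ BV·s` with `BV := BV⋆·(2(1+1∕κ₁))³`, `BV⋆ = C_G∕2` member-free (printed), `κ₁ = min r ¼ ∕ 2`
([Balaban1985BackgroundPropagators] Thm 3.3 (3.47)₁ `|Gf| ≤ B|f|`, sup currency, every member under the budgets).  PROOF: §1 for the value reader with the block letter (Gb)-K.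
[cite: Balaban1985BackgroundPropagators, Thm 3.3 (3.46)–(3.49) pp.398–399, Thm 3.1 (3.42) p.397, Thm 3.11 p.416, Thm 3.12 p.423] -/
theorem value_GT_DeltaEtaSlot_sup_kfree (hnK : n < K) {ε₀ : ℝ} (hε₀ : 0 < ε₀) (hWε : 10 ^ 12 * (F.L : ℝ) ^ 3 * ε₀ ≤ 1)
    (hε10 : 10 ^ 10 * (F.L : ℝ) ^ 6 * ε₀ ≤ 1) (hwin : 13 * 10 ^ 14 * (F.L : ℝ) ^ 3 * ε₀ ≤ 1)
    (U₀ : GaugeField (F.P K) 0 (Matrix.specialUnitaryGroup (Fin 2) ℂ)) (hreg : RegPr F n K ε₀ U₀)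
    (hlift : ∀ cf : Site (F.P K) (K - n) → Matrix (Fin 2) (Fin 2) ℂ,
        (∀ e : PBond (F.P K) (K - n), cf e.src = ((emlIterU (K - n) (bgUnits F K U₀) e : (Matrix (Fin 2) (Fin 2) ℂ)ˣ) : Matrix (Fin 2) (Fin 2) ℂ) * cf e.tgt *
          (((emlIterU (K - n) (bgUnits F K U₀) e)⁻¹ : (Matrix (Fin 2) (Fin 2) ℂ)ˣ) : Matrix (Fin 2) (Fin 2) ℂ)) →
        ∃ l₀ : Site (F.P K) 0 → Matrix (Fin 2) (Fin 2) ℂ,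
          (∀ b : PBond (F.P K) 0, l₀ b.src = ((bgUnits F K U₀ b : (Matrix (Fin 2) (Fin 2) ℂ)ˣ) : Matrix (Fin 2) (Fin 2) ℂ) * l₀ b.tgt * (((bgUnits F K U₀ b)⁻¹ : (Matrix (Fin 2) (Fin 2) ℂ)ˣ) : Matrix (Fin 2) (Fin 2) ℂ)) ∧
          ∀ y : Site (F.P K) (K - n), l₀ (embIter (K - n) y) = cf y)
    {a a₁ : ℝ} (ha : 0 ≤ a) (ha₁ : a ≤ a₁ * (c₀ / cB) * ((F.L : ℝ) ^ (K - n)) ^ 3)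
    {γ : ℝ} (hγ : 0 < γ) (hco : ∀ v : BondL2K ℂ 3 (periodsT3 F K) c₀ W₂, γ * ‖v‖ ^ 2 ≤ RCLike.re ⟪v, laplaceA F n K h c₀ cB a (DeltaEtaSlot F n K c₀) U₀ v⟫_ℂ)
    {CK δK : ℝ} (hCK : 0 ≤ CK) (hδK : 0 < δK)
    (hkD : ∀ (b : PBond (F.P K) 0) (Z : Matrix (Fin 2) (Fin 2) ℂ) (bd : PBond (F.P K) 0),
      ‖(toL2 F K c₀).symm (DL2 F n K c₀ U₀ (DstarL2 F n K c₀ U₀ (toL2 F K c₀ (Pi.single b Z))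
          - RS F n K h c₀ cB U₀ (DstarL2 F n K c₀ U₀ (toL2 F K c₀ (Pi.single b Z))))) bd‖
        ≤ CK * ((F.L : ℝ) ^ (K - n))⁻¹ ^ 3 * Real.exp (-(δK * (Site.tdist (P := F.P K) (iterBlockOf (K - n) b.src) (iterBlockOf (K - n) bd.src) : ℝ))) * ‖Z‖)
    {r ε : ℝ} (hr : 0 < r) (hr4 : r ≤ 1 / 4) (hrδ : r ≤ δK / 2) (hε : 0 < ε) (hε8 : ε ≤ 1 / 8)
    (hεC : ε * (32 * Real.sqrt 2 * 648 + (33 / 8 : ℝ) ^ 2 * (600 * (27 / 4 : ℝ) ^ 6)) ≤ γ / 8) (hrγ : r ≤ γ * ε / 48)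
    (hrT : r * (5000 * a₁ + 27 * Real.sqrt 2 * CK * (2 * (1 + 4 / δK)) ^ 3 / min 1 (δK / 4)) ≤ γ / 16) (hαγ : 10 ^ 5 * ε₀ ≤ γ / 16) :
    ∀ (X : PBond (F.P K) 0 → Matrix (Fin 2) (Fin 2) ℂ) (s : ℝ), (∀ b, ‖X b‖ ≤ s) →
      ∀ bd : PBond (F.P K) 0, ‖(toL2 F K c₀).symm (GT F n K h c₀ cB a (DeltaEtaSlot F n K c₀) U₀ (toL2 F K c₀ X)) bd‖
        ≤ ((2 * ((Real.sqrt 2 + Real.sqrt 2 * ((50 * a₁ * Real.exp δK + CK) * (3 * Real.sqrt 2) * (Real.exp (6 * r) * (2 / γ)) * (2 * (1 + 2 / δK)) ^ 3)) * (8 * Real.exp (3 * r)) * 14 + 36 * (Real.sqrt (8 * Real.exp (3 * r) * (2 * (1 + 1 / r)) ^ 3) * (Real.exp (6 * r) * (2 / γ))))) * (2 * (1 + 1 / (min r (1 / 4) / 2))) ^ 3) * s := by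
  intro X s hX bd
  have hk1 : 0 < (min r (1 / 4) / 2) := by have := lt_min hr (by norm_num : (0 : ℝ) < 1 / 4); positivity
  haveI : Nonempty (PBond (F.P K) 0) := ⟨bd⟩
  exact sup_of_blockSupported (fun b : PBond (F.P K) 0 => iterBlockOf (K - n) b.src) (fun b : PBond (F.P K) 0 => iterBlockOf (K - n) b.src)
    (fun (Y : PBond (F.P K) 0 → Matrix (Fin 2) (Fin 2) ℂ) (bd' : PBond (F.P K) 0) =>
      (toL2 F K c₀).symm (GT F n K h c₀ cB a (DeltaEtaSlot F n K c₀) U₀ (toL2 F K c₀ Y)) bd')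
    (valueReader_blockAdditive F h c₀ cB a U₀) hk1
    (blockSup_GT_DeltaEtaSlot_kfree F h c₀ cB hnK hε₀ hWε hε10 hwin U₀ hreg hlift ha ha₁ hγ hco hCK hδK hkD hr hr4 hrδ hε hε8 hεC hrγ hrT hαγ)
    X s hX bd

/-- ★★★ **(D0)-K: THE SUP COVARIANT-DIVERGENCE ROW OF `G₀` ON SUP-BOUNDED SOURCES, UNDER `Lift`, MEMBER-FREE CONSTANT** — hypotheses = ✓`divergence_GT_DeltaEtaSlot_kfree`'s VERBATIM
((V0)-K's + the no-wrap room + the K-free gradient margin `C_g·(48ε₀(6√2√10 + 6√2))·e^{51∕8} ≤ ½`); conclusion = FILE C ∕ (O-G1)'s `hDiv` binder TEXT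
`∀ X s, (∀ b, ‖X b‖ ≤ s) → ∀ x, ‖toL2S⁻¹(D*_{U₀}(G₀(toL2 X))) x‖ ≤ BD·s` with `BD := C_D⋆·(2(1+1∕κ₁))³`, `C_D⋆` member-free (printed), `κ₁ = min r ¼ ∕ 2`
([Balaban1985BackgroundPropagators] Thm 3.1 (3.42) `|G∇*|, |∇G|`-class row for the member's `G₀`, sup currency).  PROOF: §1 for the divergence reader with the block letter (dκ)-K.
[cite: Balaban1985BackgroundPropagators, Thm 3.1 (3.42)–(3.47) pp.397–399, (3.49) p.399, Thm 3.11 p.416, Thm 3.12 p.422; Balaban1985Variational, (134)–(135) p.298] -/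
theorem divergence_GT_DeltaEtaSlot_sup_kfree (hnK : n < K) {ε₀ : ℝ} (hε₀ : 0 < ε₀) (hWε : 10 ^ 12 * (F.L : ℝ) ^ 3 * ε₀ ≤ 1)
    (hε10 : 10 ^ 10 * (F.L : ℝ) ^ 6 * ε₀ ≤ 1) (hwin : 13 * 10 ^ 14 * (F.L : ℝ) ^ 3 * ε₀ ≤ 1)
    (U₀ : GaugeField (F.P K) 0 (Matrix.specialUnitaryGroup (Fin 2) ℂ)) (hreg : RegPr F n K ε₀ U₀)
    (hlift : ∀ cf : Site (F.P K) (K - n) → Matrix (Fin 2) (Fin 2) ℂ,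
        (∀ e : PBond (F.P K) (K - n), cf e.src = ((emlIterU (K - n) (bgUnits F K U₀) e : (Matrix (Fin 2) (Fin 2) ℂ)ˣ) : Matrix (Fin 2) (Fin 2) ℂ) * cf e.tgt *
          (((emlIterU (K - n) (bgUnits F K U₀) e)⁻¹ : (Matrix (Fin 2) (Fin 2) ℂ)ˣ) : Matrix (Fin 2) (Fin 2) ℂ)) →
        ∃ l₀ : Site (F.P K) 0 → Matrix (Fin 2) (Fin 2) ℂ,
          (∀ b : PBond (F.P K) 0, l₀ b.src = ((bgUnits F K U₀ b : (Matrix (Fin 2) (Fin 2) ℂ)ˣ) : Matrix (Fin 2) (Fin 2) ℂ) * l₀ b.tgt * (((bgUnits F K U₀ b)⁻¹ : (Matrix (Fin 2) (Fin 2) ℂ)ˣ) : Matrix (Fin 2) (Fin 2) ℂ)) ∧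
          ∀ y : Site (F.P K) (K - n), l₀ (embIter (K - n) y) = cf y)
    {a a₁ : ℝ} (ha : 0 ≤ a) (ha₁ : a ≤ a₁ * (c₀ / cB) * ((F.L : ℝ) ^ (K - n)) ^ 3)
    {γ : ℝ} (hγ : 0 < γ) (hco : ∀ v : BondL2K ℂ 3 (periodsT3 F K) c₀ W₂, γ * ‖v‖ ^ 2 ≤ RCLike.re ⟪v, laplaceA F n K h c₀ cB a (DeltaEtaSlot F n K c₀) U₀ v⟫_ℂ)
    {CK δK : ℝ} (hCK : 0 ≤ CK) (hδK : 0 < δK)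
    (hkD : ∀ (b : PBond (F.P K) 0) (Z : Matrix (Fin 2) (Fin 2) ℂ) (bd : PBond (F.P K) 0),
      ‖(toL2 F K c₀).symm (DL2 F n K c₀ U₀ (DstarL2 F n K c₀ U₀ (toL2 F K c₀ (Pi.single b Z))
          - RS F n K h c₀ cB U₀ (DstarL2 F n K c₀ U₀ (toL2 F K c₀ (Pi.single b Z))))) bd‖
        ≤ CK * ((F.L : ℝ) ^ (K - n))⁻¹ ^ 3 * Real.exp (-(δK * (Site.tdist (P := F.P K) (iterBlockOf (K - n) b.src) (iterBlockOf (K - n) bd.src) : ℝ))) * ‖Z‖)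
    {r ε : ℝ} (hr : 0 < r) (hr4 : r ≤ 1 / 4) (hrδ : r ≤ δK / 2) (hε : 0 < ε) (hε8 : ε ≤ 1 / 8)
    (hεC : ε * (32 * Real.sqrt 2 * 648 + (33 / 8 : ℝ) ^ 2 * (600 * (27 / 4 : ℝ) ^ 6)) ≤ γ / 8) (hrγ : r ≤ γ * ε / 48)
    (hrT : r * (5000 * a₁ + 27 * Real.sqrt 2 * CK * (2 * (1 + 4 / δK)) ^ 3 / min 1 (δK / 4)) ≤ γ / 16) (hαγ : 10 ^ 5 * ε₀ ≤ γ / 16)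
    (hroom : 2 * (12 * F.L ^ (K - n) + 5) ≤ (F.P K).sitesPerDir 0)
    (hsmall : exists_curved_localGradient.choose * ((48 * ε₀) * (6 * Real.sqrt 2 * Real.sqrt 10 + 6 * Real.sqrt 2)) * Real.exp (51 / 8) ≤ 1 / 2) :
    ∀ (X : PBond (F.P K) 0 → Matrix (Fin 2) (Fin 2) ℂ) (s : ℝ), (∀ b, ‖X b‖ ≤ s) →
      ∀ x : Site (F.P K) 0, ‖(toL2S F K c₀).symm (DstarL2 F n K c₀ U₀ (GT F n K h c₀ cB a (DeltaEtaSlot F n K c₀) U₀ (toL2 F K c₀ X))) x‖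
        ≤ ((3 * (Real.exp (4 / 8) * (2 * ((exists_curved_localGradient.choose * (((Real.sqrt 2 * (2 * ((Real.sqrt 2 + Real.sqrt 2 * ((50 * a₁ * Real.exp δK + CK) * (3 * Real.sqrt 2) * (Real.exp (6 * r) * (2 / γ)) * (2 * (1 + 2 / δK)) ^ 3)) * (8 * Real.exp (3 * r)) * 14 + 36 * (Real.sqrt (8 * Real.exp (3 * r) * (2 * (1 + 1 / r)) ^ 3) * (Real.exp (6 * r) * (2 / γ)))))) * Real.exp (51 / 8)) * (2 + 2 * Real.sqrt 2 * (4 * ε₀ * (3 + 2457 * norm_bgOfCfg_axialT_sub_le.choose)) + (24 * Real.sqrt 10 + 48) * (48 * ε₀) ^ 2) + (Real.sqrt 2 * ((32 * ε₀ * ((2 * ((Real.sqrt 2 + Real.sqrt 2 * ((50 * a₁ * Real.exp δK + CK) * (3 * Real.sqrt 2) * (Real.exp (6 * r) * (2 / γ)) * (2 * (1 + 2 / δK)) ^ 3)) * (8 * Real.exp (3 * r)) * 14 + 36 * (Real.sqrt (8 * Real.exp (3 * r) * (2 * (1 + 1 / r)) ^ 3) * (Real.exp (6 * r) * (2 / γ)))))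 * Real.exp (5 / 8))) + (CK * (3 * Real.sqrt 2) * (Real.exp (6 * r) * (2 / γ)) * (2 * (1 + 2 / δK)) ^ 3) + ((50 * a₁ * Real.exp δK) * (3 * Real.sqrt 2) * (Real.exp (6 * r) * (2 / γ)) * (2 * (1 + 2 / δK)) ^ 3) + 1)) * Real.exp (51 / 8)) + 2 * Real.sqrt 2 * (48 * ε₀) * ((Real.sqrt 2 * (2 * ((Real.sqrt 2 + Real.sqrt 2 * ((50 * a₁ * Real.exp δK + CK) * (3 * Real.sqrt 2) * (Real.exp (6 * r) * (2 / γ)) * (2 * (1 + 2 / δK)) ^ 3)) * (8 * Real.exp (3 * r)) * 14 + 36 * (Real.sqrt (8 * Real.exp (3 * r) * (2 * (1 + 1 / r)) ^ 3) * (Real.exp (6 * r) * (2 / γ)))))) * Real.exp (51 / 8))))))) * (2 * (1 + 1 / (min r (1 / 4) / 2))) ^ 3) * s := by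
  intro X s hX x
  have hk1 : 0 < (min r (1 / 4) / 2) := by have := lt_min hr (by norm_num : (0 : ℝ) < 1 / 4); positivity
  haveI : Nonempty (PBond (F.P K) 0) := ⟨⟨x, ⟨0, by rw [T3Family.P_d]; norm_num⟩⟩⟩
  exact sup_of_blockSupported (fun b : PBond (F.P K) 0 => iterBlockOf (K - n) b.src) (fun x' : Site (F.P K) 0 => iterBlockOf (K - n) x')
    (fun (Y : PBond (F.P K) 0 → Matrix (Fin 2) (Fin 2) ℂ) (x' : Site (F.P K) 0) =>
      (toL2S F K c₀).symm (DstarL2 F n K c₀ U₀ (GT F n K h c₀ cB a (DeltaEtaSlot F n K c₀) U₀ (toL2 F K c₀ Y))) x')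
    (divReader_blockAdditive F h c₀ cB a U₀) hk1
    (divergence_GT_DeltaEtaSlot_kfree F h c₀ cB hnK hε₀ hWε hε10 hwin U₀ hreg hlift ha ha₁ hγ hco hCK hδK hkD hr hr4 hrδ hε hε8 hεC hrγ hrT hαγ hroom hsmall)
    X s hX x

/-- ★★ **(V0)+(D0)-K AS ONE `∃`-PAIR WITH SIGNS — FILE C ∕ (O-G1)'s `hBV hBD hV hDiv` SLOTS, TEXTS VERBATIM** (inner binders `∀ b` ∕ `∀ x` as FILE C prints them): under the
(D0)-K hypotheses, `∃ BV BD : ℝ, 0 ≤ BV ∧ 0 ≤ BD ∧ hV-text ∧ hDiv-text`.  The signs are read off the rows at the zero source; the witnesses are §3's printed constants.  This is the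
dockable edition for an `∃`-assembly (`obtain ⟨BV, BD, hBV, hBD, hV, hDiv⟩ := …` then FILE C ∕ (O-G1) by name). [cite: Balaban1985BackgroundPropagators, Thm 3.3 (3.47) p.398, Thm 3.12 p.422–423] -/
theorem exists_valueDiv_sup_kfree (hnK : n < K) {ε₀ : ℝ} (hε₀ : 0 < ε₀) (hWε : 10 ^ 12 * (F.L : ℝ) ^ 3 * ε₀ ≤ 1)
    (hε10 : 10 ^ 10 * (F.L : ℝ) ^ 6 * ε₀ ≤ 1) (hwin : 13 * 10 ^ 14 * (F.L : ℝ) ^ 3 * ε₀ ≤ 1)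
    (U₀ : GaugeField (F.P K) 0 (Matrix.specialUnitaryGroup (Fin 2) ℂ)) (hreg : RegPr F n K ε₀ U₀)
    (hlift : ∀ cf : Site (F.P K) (K - n) → Matrix (Fin 2) (Fin 2) ℂ,
        (∀ e : PBond (F.P K) (K - n), cf e.src = ((emlIterU (K - n) (bgUnits F K U₀) e : (Matrix (Fin 2) (Fin 2) ℂ)ˣ) : Matrix (Fin 2) (Fin 2) ℂ) * cf e.tgt *
          (((emlIterU (K - n) (bgUnits F K U₀) e)⁻¹ : (Matrix (Fin 2) (Fin 2) ℂ)ˣ) : Matrix (Fin 2) (Fin 2) ℂ)) →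
        ∃ l₀ : Site (F.P K) 0 → Matrix (Fin 2) (Fin 2) ℂ,
          (∀ b : PBond (F.P K) 0, l₀ b.src = ((bgUnits F K U₀ b : (Matrix (Fin 2) (Fin 2) ℂ)ˣ) : Matrix (Fin 2) (Fin 2) ℂ) * l₀ b.tgt * (((bgUnits F K U₀ b)⁻¹ : (Matrix (Fin 2) (Fin 2) ℂ)ˣ) : Matrix (Fin 2) (Fin 2) ℂ)) ∧
          ∀ y : Site (F.P K) (K - n), l₀ (embIter (K - n) y) = cf y)
    {a a₁ : ℝ} (ha : 0 ≤ a) (ha₁ : a ≤ a₁ * (c₀ / cB) * ((F.L : ℝ) ^ (K - n)) ^ 3)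
    {γ : ℝ} (hγ : 0 < γ) (hco : ∀ v : BondL2K ℂ 3 (periodsT3 F K) c₀ W₂, γ * ‖v‖ ^ 2 ≤ RCLike.re ⟪v, laplaceA F n K h c₀ cB a (DeltaEtaSlot F n K c₀) U₀ v⟫_ℂ)
    {CK δK : ℝ} (hCK : 0 ≤ CK) (hδK : 0 < δK)
    (hkD : ∀ (b : PBond (F.P K) 0) (Z : Matrix (Fin 2) (Fin 2) ℂ) (bd : PBond (F.P K) 0),
      ‖(toL2 F K c₀).symm (DL2 F n K c₀ U₀ (DstarL2 F n K c₀ U₀ (toL2 F K c₀ (Pi.single b Z))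
          - RS F n K h c₀ cB U₀ (DstarL2 F n K c₀ U₀ (toL2 F K c₀ (Pi.single b Z))))) bd‖
        ≤ CK * ((F.L : ℝ) ^ (K - n))⁻¹ ^ 3 * Real.exp (-(δK * (Site.tdist (P := F.P K) (iterBlockOf (K - n) b.src) (iterBlockOf (K - n) bd.src) : ℝ))) * ‖Z‖)
    {r ε : ℝ} (hr : 0 < r) (hr4 : r ≤ 1 / 4) (hrδ : r ≤ δK / 2) (hε : 0 < ε) (hε8 : ε ≤ 1 / 8)
    (hεC : ε * (32 * Real.sqrt 2 * 648 + (33 / 8 : ℝ) ^ 2 * (600 * (27 / 4 : ℝ) ^ 6)) ≤ γ / 8) (hrγ : r ≤ γ * ε / 48)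
    (hrT : r * (5000 * a₁ + 27 * Real.sqrt 2 * CK * (2 * (1 + 4 / δK)) ^ 3 / min 1 (δK / 4)) ≤ γ / 16) (hαγ : 10 ^ 5 * ε₀ ≤ γ / 16)
    (hroom : 2 * (12 * F.L ^ (K - n) + 5) ≤ (F.P K).sitesPerDir 0)
    (hsmall : exists_curved_localGradient.choose * ((48 * ε₀) * (6 * Real.sqrt 2 * Real.sqrt 10 + 6 * Real.sqrt 2)) * Real.exp (51 / 8) ≤ 1 / 2) :
    ∃ BV BD : ℝ, 0 ≤ BV ∧ 0 ≤ BD ∧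
      (∀ (X : PBond (F.P K) 0 → Matrix (Fin 2) (Fin 2) ℂ) (s : ℝ), (∀ b, ‖X b‖ ≤ s) →
        ∀ b, ‖(toL2 F K c₀).symm (GT F n K h c₀ cB a (DeltaEtaSlot F n K c₀) U₀ (toL2 F K c₀ X)) b‖ ≤ BV * s) ∧
      (∀ (X : PBond (F.P K) 0 → Matrix (Fin 2) (Fin 2) ℂ) (s : ℝ), (∀ b, ‖X b‖ ≤ s) →
        ∀ x, ‖(toL2S F K c₀).symm (DstarL2 F n K c₀ U₀ (GT F n K h c₀ cB a (DeltaEtaSlot F n K c₀) U₀ (toL2 F K c₀ X))) x‖ ≤ BD * s) := by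
  have hV := value_GT_DeltaEtaSlot_sup_kfree F h c₀ cB hnK hε₀ hWε hε10 hwin U₀ hreg hlift ha ha₁ hγ hco hCK hδK hkD hr hr4 hrδ hε hε8 hεC hrγ hrT hαγ
  have hD := divergence_GT_DeltaEtaSlot_sup_kfree F h c₀ cB hnK hε₀ hWε hε10 hwin U₀ hreg hlift ha ha₁ hγ hco hCK hδK hkD hr hr4 hrδ hε hε8 hεC hrγ hrT hαγ hroom hsmall
  -- signs off the rows at the ZERO source (`s := 1`)
  obtain ⟨x₀⟩ : Nonempty (Site (F.P K) 0) := inferInstance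
  have b₀ : PBond (F.P K) 0 := ⟨x₀, ⟨0, by rw [T3Family.P_d]; norm_num⟩⟩
  have h1 : ∀ b : PBond (F.P K) 0, ‖(fun _ : PBond (F.P K) 0 => (0 : Matrix (Fin 2) (Fin 2) ℂ)) b‖ ≤ 1 := fun _ => by rw [norm_zero]; exact zero_le_one
  refine ⟨_, _, ?_, ?_, hV, hD⟩
  · have h0 := hV (fun _ => 0) 1 h1 b₀
    rw [mul_one] at h0
    exact (norm_nonneg _).trans h0
  · have h0 := hD (fun _ => 0) 1 h1 x₀
    rw [mul_one] at h0
    exact (norm_nonneg _).trans h0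

end KFree


end Summit.QuantumFields.YangMills.Theorems.Prop7OneFormGreenSupRowsOfBlockRows

end
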